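import Summits.QuantumFields.Balaban3D.Proofs.FluctGaussSU2
import Summits.QuantumFields.Balaban3D.Carriers.Standard

/-!
# `Summit.QuantumFields.Balaban3D.Proofs.StarCountFree` — print's `|Ω₁*|` IS the number of free fluctuation variables of the lane's
# gauge-fixed first-step integral at `Ω₁ = T₁`: [Balaban1985UV3] p. 260 (after (18)) «|Ω₁*| denotes the number of bonds belonging to Ω₁
# minus the number of bonds in Ω₁^{(1)} and minus the number of bonds in the axial gauge fixing set» — LQB's `B10StarCount.starCount univ` —
# equals `#{free bonds}` = all fine bonds minus the radial forest (axial gauge fixing set, (9) p. 258) minus the crossing bonds (one per coarse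
# bond, the `δ((U′U₁)‾ V⁻¹)` constraints of (13)), the index type `Free` of `…Proofs.FluctGaussSU2` over which (18)/(22) integrate
# (seat p4, lane `pub-balaban3d`; FIBRE49.md (S4) «starB(triv) CHECKED … to prove: (radialBonds univ).card = n_k − n_{k+1}»).

HONEST FRAMING (lane PLAN.md §0, binding): see `…Proofs.SectAFirstStep`.  [folklore] lattice combinatorics: (i) the radial forest of all blocks is
in bijection, by its fresh ends, with the non-central fine sites, so `#forest = |T^{(k)}| − |T^{(k+1)}|`; (ii) the crossing bonds are `d·|T^{(k+1)}|`
and disjoint from the forest; (iii) hence `#Free = d|T^{(k)}| − (|T^{(k)}| − |T^{(k+1)}|) − d|T^{(k+1)}| = (d − 1)(L^d − 1)|T^{(k+1)}| = |T₁^{(k)*|`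
(`B10StarCount.starCount_univ`); (iv) for the lane's standard pieces (`Carriers.Standard.piecesParamsOf`, `starB h := starCount (Λ_{k+1}(h))`,
`Λ₁(triv) = T^{(1)}`) this DISCHARGES the data pin `hstar` of `…FibreZeroSU2.fibre_pair_zero_of_pins` / `…FibreZeroSU2Regular.fibre_pair_zero`.
Nothing of the paper is asserted.
-/

open Finset

namespace Summit.QuantumFields.Balaban3D.Proofs.StarCountFree

open Literature.MathematicalPhysics.QuantumFieldTheory.Balaban1983to89
open Literature.MathematicalPhysics.QuantumFieldTheory.Balaban1983to89.B10StarCount (starCount starCount_univ card_pbond)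
open Literature.MathematicalPhysics.QuantumFieldTheory.Balaban1985CMP102
open Literature.MathematicalPhysics.QuantumFieldTheory.Balaban1985CMP102.Setting
open Summit.QuantumFields.Balaban3D.Carriers
open Summit.QuantumFields.Balaban3D.Proofs.AxialGauge (crossBond crossBond_injective crossBond_not_mem_radialBonds off_blockSite)
open Summit.QuantumFields.Balaban3D.Proofs.AxialGaugeFix (forest)
open Summit.QuantumFields.Balaban3D.Proofs.FluctChartSU2 (IsDummy)
open Summit.QuantumFields.Balaban3D.Proofs.FluctGaussSU2 (Free)

variable {P : Params} {j : ℕ}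

/-! ## §1 Central and non-central fine sites -/

/-- The inclusion of the coarse lattice `emb : T^{(j+1)} → T^{(j)}` (block centres) is injective. [folklore] -/
theorem emb_injective (hj : j + 1 ≤ P.m + P.K) : Function.Injective (emb : Site P (j + 1) → Site P j) := fun y y' h => by
  have := congrArg blockOf h
  rwa [Site.blockOf_emb hj, Site.blockOf_emb hj] at this

/-- A fine site all of whose offsets are central IS the centre of its block. [folklore] -/
theorem eq_emb_blockOf_of_off (hj : j + 1 ≤ P.m + P.K) (x : Site P j) (h : ∀ κ, off x κ = (P.L - 1) / 2) :
    x = emb (blockOf x) := by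
  have key : (Site.blockEquiv hj (blockOf x)) ⟨x, rfl⟩
      = (Site.blockEquiv hj (blockOf x)) ⟨emb (blockOf x), Site.blockOf_emb hj _⟩ := by
    funext μ
    apply Fin.ext
    show (x μ).val % P.L = ((emb (blockOf x)) μ).val % P.L
    exact (h μ).trans (off_emb hj (blockOf x) μ).symm
  exact congrArg Subtype.val ((Site.blockEquiv hj (blockOf x)).injective key)

/-- The block centres, as a set of fine sites, are the image of `emb`; membership = «`x` is the centre of its own block». [folklore] -/
theorem mem_image_emb_iff (hj : j + 1 ≤ P.m + P.K) (x : Site P j) :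
    x ∈ (univ : Finset (Site P (j + 1))).image emb ↔ x = emb (blockOf x) := by
  constructor
  · rintro hx
    obtain ⟨y, -, rfl⟩ := mem_image.1 hx
    rw [Site.blockOf_emb hj]
  · intro hx
    exact mem_image.2 ⟨blockOf x, mem_univ _, hx.symm⟩

/-- There are `|T^{(j+1)}|` block centres. [folklore] -/
theorem card_image_emb (hj : j + 1 ≤ P.m + P.K) :
    ((univ : Finset (Site P (j + 1))).image (emb : Site P (j + 1) → Site P j)).card = Fintype.card (Site P (j + 1)) := by
  rw [card_image_of_injective _ (emb_injective hj), card_univ]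

/-- There are `|T^{(j)}| − |T^{(j+1)}|` NON-central fine sites. [folklore] -/
theorem card_filter_ne_emb (hj : j + 1 ≤ P.m + P.K) :
    ((univ : Finset (Site P j)).filter (fun x => x ≠ emb (blockOf x))).card
      = Fintype.card (Site P j) - Fintype.card (Site P (j + 1)) := by
  have h := card_filter_add_card_filter_not (s := (univ : Finset (Site P j))) (fun x => x = emb (blockOf x))
  have h1 : (univ : Finset (Site P j)).filter (fun x => x = emb (blockOf x)) = (univ : Finset (Site P (j + 1))).image emb := by
    ext x
    rw [mem_filter, mem_image_emb_iff hj]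
    simp
  have h2 : (univ : Finset (Site P j)).filter (fun x => x ≠ emb (blockOf x))
      = (univ : Finset (Site P j)).filter (fun x => ¬ x = emb (blockOf x)) := filter_congr fun _ _ => Iff.rfl
  rw [h1, card_image_emb hj, card_univ] at h
  rw [h2]
  omega

/-! ## §2 The radial forest of all blocks has `|T^{(j)}| − |T^{(j+1)}|` bonds -/

/-- Fresh ends of forest bonds are never block centres. [folklore] -/
theorem radialFresh_ne_emb (hj : j + 1 ≤ P.m + P.K) {b : PBond P j} (hb : b ∈ forest P j) :
    radialFresh b ≠ emb (blockOf (radialFresh b)) :=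
  fun h => emb_ne_radialFresh hj hb (blockOf (radialFresh b)) h.symm

/-- Every NON-central fine site is the fresh end of a bond of the radial forest of all blocks: the last bond of its contour `Γ_{y,x}` — it
adjusts the FIRST non-central coordinate (the contour moves along the last coordinate first), all earlier coordinates being central. [folklore] -/
theorem exists_radialFresh_eq (hj : j + 1 ≤ P.m + P.K) (x : Site P j) (hx : x ≠ emb (blockOf x)) :
    ∃ b ∈ forest P j, radialFresh b = x := by
  have hL := P.hL.2
  set c : ℕ := (P.L - 1) / 2 with hc
  -- the first non-central coordinate `μ`
  set s : Finset (Fin P.d) := (univ : Finset (Fin P.d)).filter (fun κ => off x κ ≠ c) with hsdef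
  have hex : s.Nonempty := by
    by_contra hne
    rw [not_nonempty_iff_eq_empty, hsdef, filter_eq_empty_iff] at hne
    exact hx (eq_emb_blockOf_of_off hj x fun κ => by simpa using hne (mem_univ κ))
  set μ : Fin P.d := s.min' hex with hμdef
  have hμ : off x μ ≠ c := by
    have hm : μ ∈ s := min'_mem s hex
    rw [hsdef, mem_filter] at hm
    exact hm.2
  have hmin : ∀ κ, κ < μ → off x κ = c := by
    intro κ hκ
    by_contra hne
    have hκs : κ ∈ s := by rw [hsdef, mem_filter]; exact ⟨mem_univ κ, hne⟩
    have : μ ≤ κ := min'_le s κ hκs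
    exact absurd hκ (not_lt.2 this)
  have hoff := off_lt x μ
  rcases lt_or_gt_of_ne hμ with hlt | hgt
  · -- `x` lies BELOW the centre along `μ`: the bond `⟨x, x + e_μ⟩`, fresh end = its source `x`
    refine ⟨⟨x, μ⟩, ?_, ?_⟩
    · rw [AxialGaugeFix.forest, mem_radialBonds]
      exact ⟨mem_univ _, by simp only; omega, fun κ hκ => hmin κ hκ⟩
    · unfold radialFresh
      rw [if_neg (by simp only; omega)]
  · -- `x` lies ABOVE the centre along `μ`: the bond `⟨x − e_μ, x⟩`, fresh end = its target `x`
    set r : Fin P.d → Fin P.L := (Site.blockEquiv hj (blockOf x)) ⟨x, rfl⟩ with hrdef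
    have hxr : Site.blockSite (blockOf x) r = x := congrArg Subtype.val ((Site.blockEquiv hj (blockOf x)).symm_apply_apply ⟨x, rfl⟩)
    have hr : ∀ κ, ((r κ : ℕ)) = off x κ := fun κ => rfl
    set r' : Fin P.d → Fin P.L := Function.update r μ ⟨off x μ - 1, by omega⟩ with hr'def
    have hr'μ : ((r' μ : ℕ)) = off x μ - 1 := by rw [hr'def, Function.update_self]
    have hr'ne : ∀ κ, κ ≠ μ → r' κ = r κ := fun κ hκ => by rw [hr'def, Function.update_of_ne hκ]
    set z : Site P j := Site.blockSite (blockOf x) r' with hzdef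
    have hzμ : off z μ = off x μ - 1 := by rw [hzdef, off_blockSite hj, hr'μ]
    have hshift : z.shift μ = x := by
      funext ν
      by_cases hν : ν = μ
      · rw [hν, shift_apply_self, hzdef]
        conv_rhs => rw [← hxr]
        show (((((blockOf x) μ).val * P.L + (r' μ : ℕ) : ℕ)) : ZMod (P.sitesPerDir j)) + 1
          = ((((blockOf x) μ).val * P.L + (r μ : ℕ) : ℕ) : ZMod (P.sitesPerDir j))
        rw [hr'μ, hr μ, show ((blockOf x) μ).val * P.L + off x μ = ((blockOf x) μ).val * P.L + (off x μ - 1) + 1 by omega,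
          Nat.cast_succ]
      · rw [shift_apply_ne z hν, hzdef]
        conv_rhs => rw [← hxr]
        show ((((blockOf x) ν).val * P.L + (r' ν : ℕ) : ℕ) : ZMod (P.sitesPerDir j))
          = ((((blockOf x) ν).val * P.L + (r ν : ℕ) : ℕ) : ZMod (P.sitesPerDir j))
        rw [hr'ne ν hν]
    refine ⟨⟨z, μ⟩, ?_, ?_⟩
    · rw [AxialGaugeFix.forest, mem_radialBonds]
      refine ⟨mem_univ _, by simp only; omega, fun κ hκ => ?_⟩
      show off z κ = c
      rw [hzdef, off_blockSite hj, hr'ne κ (ne_of_lt hκ), hr κ]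
      exact hmin κ hκ
    · unfold radialFresh
      rw [if_pos (by simp only; omega)]
      exact hshift

/-- The fresh-end map sends the radial forest of all blocks ONTO the non-central fine sites. [folklore] -/
theorem image_radialFresh_forest (hj : j + 1 ≤ P.m + P.K) :
    (forest P j).image radialFresh = (univ : Finset (Site P j)).filter (fun x => x ≠ emb (blockOf x)) := by
  ext x
  simp only [mem_image, mem_filter, mem_univ, true_and]
  constructor
  · rintro ⟨b, hb, rfl⟩
    exact radialFresh_ne_emb hj hb
  · exact fun hx => exists_radialFresh_eq hj x hx

/-- **`#forest = |T^{(j)}| − |T^{(j+1)}|`**: one axial gauge condition per non-central site of each block ((9) p. 258, «x ∈ B(y), x ≠ y»),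
realised by the radial forest's fresh-end bijection. [cite: Balaban1985UV3, (9) p.258] -/
theorem card_forest (hj : j + 1 ≤ P.m + P.K) :
    (forest P j).card = Fintype.card (Site P j) - Fintype.card (Site P (j + 1)) := by
  have hinj : Set.InjOn radialFresh (forest P j : Set (PBond P j)) := fun b hb b' hb' h =>
    (treeOrder_radialBonds hj _).inj b hb b' hb' h
  rw [← card_image_of_injOn hinj, image_radialFresh_forest hj, card_filter_ne_emb hj]

/-! ## §3 Dummy bonds and free bonds -/

variable [DecidableEq (PBond P j)]

/-- The crossing bonds (one per coarse bond) number `d·|T^{(j+1)}|`. [folklore] -/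
theorem card_image_crossBond (hj : j + 1 ≤ P.m + P.K) :
    ((univ : Finset (PBond P (j + 1))).image (crossBond : PBond P (j + 1) → PBond P j)).card
      = P.d * Fintype.card (Site P (j + 1)) := by
  rw [card_image_of_injective _ (crossBond_injective hj), card_univ, card_pbond]

/-- The radial forest and the crossing bonds are disjoint. [folklore] -/
theorem disjoint_forest_crossBond (hj : j + 1 ≤ P.m + P.K) :
    Disjoint (forest P j) ((univ : Finset (PBond P (j + 1))).image (crossBond : PBond P (j + 1) → PBond P j)) := by
  rw [disjoint_iff_ne]
  rintro b hb _ hc rfl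
  obtain ⟨c, -, rfl⟩ := mem_image.1 hc
  exact crossBond_not_mem_radialBonds hj _ c hb

/-- `IsDummy b` ⟺ `b ∈ forest ∪ crossing bonds`. [folklore] -/
theorem isDummy_iff_mem (b : PBond P j) :
    IsDummy b ↔ b ∈ forest P j ∪ (univ : Finset (PBond P (j + 1))).image crossBond := by
  unfold IsDummy
  rw [mem_union, mem_image]
  simp only [mem_univ, true_and]

/-- The dummy bonds number `(|T^{(j)}| − |T^{(j+1)}|) + d·|T^{(j+1)}|`. [folklore] -/
theorem card_dummy (hj : j + 1 ≤ P.m + P.K) :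
    Fintype.card {b : PBond P j // IsDummy b}
      = (Fintype.card (Site P j) - Fintype.card (Site P (j + 1))) + P.d * Fintype.card (Site P (j + 1)) := by
  rw [Fintype.card_of_subtype (forest P j ∪ (univ : Finset (PBond P (j + 1))).image crossBond)
    (fun b => (isDummy_iff_mem b).symm), card_union_of_disjoint (disjoint_forest_crossBond hj), card_forest hj,
    card_image_crossBond hj]

/-- **`#Free = |T₁^{(j)*|`** — the number of free fluctuation variables of the gauge-fixed first-step integral over all blocks equals print's
star count of the whole lattice, `(d − 1)(L^d − 1)|T^{(j+1)}|` (`B10StarCount.starCount_univ`). [cite: Balaban1985UV3, p.260 (after (18)) + (62) p.271] -/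
theorem card_free_eq_starCount (hj : j + 1 ≤ P.m + P.K) :
    (Fintype.card (Free P j) : ℤ) = starCount (univ : Finset (Site P (j + 1))) := by
  have hc := Fintype.card_subtype_compl (fun b : PBond P j => IsDummy b)
  have hle : Fintype.card {b : PBond P j // IsDummy b} ≤ Fintype.card (PBond P j) := Fintype.card_subtype_le _
  have hN := Site.card_site_eq_mul_succ hj (P := P)
  have hd := P.hd
  have hLd : 1 ≤ P.L ^ P.d := Nat.one_le_pow _ _ P.L_pos
  have hn : Fintype.card (Site P (j + 1)) ≤ Fintype.card (Site P j) := by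
    rw [hN]; exact Nat.le_mul_of_pos_left _ (by omega)
  rw [show Fintype.card (Free P j) = Fintype.card {b : PBond P j // ¬ IsDummy b} from rfl, hc, starCount_univ hj,
    Nat.cast_sub hle, card_dummy hj, card_pbond, hN]
  rw [hN] at hn
  push_cast [Nat.cast_sub hn]
  ring

/-! ## §4 The lane's standard pieces: the `hstar` pin of `fibre_pair_zero` discharged -/

/-- **For the lane's standard step parameters the pin `hstar` of `…FibreZeroSU2Regular.fibre_pair_zero` HOLDS**: at the trivial history
`Λ₁ = T^{(1)}` (`Carriers.lamFin_triv`), so `starB(triv) = |T₁^{(0)*|` (`piecesParamsOf_starB`) `= #Free` (`card_free_eq_starCount`).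
[cite: Balaban1985UV3, p.260 (after (18)) + (55) p.269] -/
theorem starB_triv_piecesParamsOf {L : ℕ} (S : Scales L) (K : CarrierConsts) [DecidableEq (PBond S.P 0)] (hj : 1 ≤ S.P.m + S.P.K) :
    (piecesParamsOf S K 0).starB (Hist.triv S.P 1) = (Fintype.card (Free S.P 0) : ℝ) := by
  rw [piecesParamsOf_starB, lamFin_triv _ _ (by simpa using hj), ← card_free_eq_starCount (by simpa using hj)]
  push_cast
  rfl

/-- The same for THE LANE'S STEP PIECES at the standard parameters (`Carriers.seriesPieces B 𝔖 (piecesParamsOf S K) 0`, whose `starB`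
is `(piecesParamsOf S K 0).starB` by construction of `pieces3`): `starB(triv) = #Free` — the `hstar` pin in the shape consumed by
`…FibreZeroSU2.fibre_pair_zero_of_pins`. [cite: Balaban1985UV3, p.260 (after (18)) + (55) p.269] -/
theorem starB_triv_seriesPieces {L : ℕ} (S : Scales L) {G : Type} [GaugeGroup G] [MeasurableSpace G] [HaarData G]
    {V : Type} [NormedAddCommGroup V] [NormedSpace ℂ V] {Nc : ℕ → ℕ} [∀ k, NeZero (Nc k)]
    (B : TowerBase S G) (𝔖 : ∀ k, StepSeries S G V (Nc k) k) (K : CarrierConsts) [DecidableEq (PBond S.P 0)]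
    (hj : 1 ≤ S.P.m + S.P.K) :
    (seriesPieces B 𝔖 (piecesParamsOf S K) 0).starB (Hist.triv S.P 1) = (Fintype.card (Free S.P 0) : ℝ) :=
  starB_triv_piecesParamsOf S K hj

end Summit.QuantumFields.Balaban3D.Proofs.StarCountFree
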